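import Summits.NavierStokesRegularity.NavierStokesRegularity.Theorems.ExtremiserTransienceNearExtremalTransienceExtremiserLiouvilleConstantSpeedSlideVerticalAverage
import HarnessLib

/-!
# Crux `ExtremiserTransience.NearExtremalTransience` (stmt-NavierStokesRegularity-21883), line `extremiser_liouville`,
# stub K1b — the discrete slide direction `φ̂_h`: `D¹φ̂_h, D²φ̂_h ∈ L²` (blueprint L1, part 3)

`--supports stmt-NavierStokesRegularity-21883` (helper).  Author: prover seat `ns-el-k1b` (g8).  Record:
`Cruxes/NearExtremalTransience/Lines/extremiser_liouville_k1b_slide.md` §11 (L1).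

The discrete slide direction `φ̂_h(x) = g(x₂)V(x) − g(x₂−h)V(x−he₂) − (∫_{−h}^{0} g′(x₂+t)V₂(x+te₂)dt)e₂` (`…SlideQuotient`)
must lie in g5's global class: `∫‖D¹φ̂_h‖² < ∞`, `∫‖D²φ̂_h‖² < ∞`.  This holds for the residue object on a LAYER:
`g ∈ C^∞` with `g, g′, g″, g‴` bounded and `g′ = g″ = g‴ = 0` off `[−T, T]`, `D¹V, D²V ∈ L²`, and the slab `{|x₂| ≤ T}` square
integrable (jet) — only `V, DV, D²V` and their vertical translates / sliding integrals occur, never `D³V`: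
* `norm_iteratedFDeriv_axialWeight_smul_le`, `norm_iteratedFDeriv_axialWeight_mul_coord_le` : Leibniz bounds for
  `g(x₂)V` and `g′(x₂)V₂`;
* `lintegral_iteratedFDeriv_axialWeight_smul_lt_top`, `…_mul_coord_lt_top` : their `D¹, D²` are in `L²`;
* `lintegral_iteratedFDeriv_slideQuotient_lt_top` : **`D¹φ̂_h, D²φ̂_h ∈ L²`** (with `…SlideVerticalAverage` for the
  sliding-integral term and `lintegral_iteratedFDeriv_add_smul_lt_top_global` for sums).

WHAT THIS IS NOT: K1b is NOT proved; nothing here proves NS regularity. [folklore]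
-/

noncomputable section

open Set Filter Topology MeasureTheory Metric Function InnerProductSpace
open scoped ENNReal NNReal Topology InnerProductSpace RealInnerProductSpace ContDiff
open Literature.Analysis.FluidPDE Literature.Analysis

namespace Summit.NavierStokesRegularity.NavierStokesRegularity.Theorems

-- the problem directory repeats the summit name (`NavierStokesRegularity/NavierStokesRegularity`)
set_option linter.dupNamespace false

namespace ExtremiserLiouville

open DepletionLadder.KStar

variable {V : EuclideanSpace ℝ (Fin 3) → EuclideanSpace ℝ (Fin 3)} {g : ℝ → ℝ}

/-! ## 1. Pointwise Leibniz bounds -/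

/-- The coordinate projection `dx₂` has operator norm `≤ 1` (local copy). [folklore] -/
private theorem norm_proj_le_one : ‖(EuclideanSpace.proj (2 : Fin 3) : EuclideanSpace ℝ (Fin 3) →L[ℝ] ℝ)‖ ≤ 1 := by
  refine ContinuousLinearMap.opNorm_le_bound _ zero_le_one fun y => ?_
  rw [one_mul, Real.norm_eq_abs]
  have := PiLp.norm_apply_le (p := 2) y 2; rwa [Real.norm_eq_abs] at this

/-- `‖Dⁱ(g ∘ x₂)(y)‖ ≤ |g⁽ⁱ⁾(y₂)|`. [folklore] -/
theorem norm_iteratedFDeriv_comp_coord_le (hg : ContDiff ℝ ∞ g) (i : ℕ) (y : EuclideanSpace ℝ (Fin 3)) :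
    ‖iteratedFDeriv ℝ i (fun z : EuclideanSpace ℝ (Fin 3) => g (z 2)) y‖ ≤ |iteratedDeriv i g (y 2)| := by
  have hfun : (fun z : EuclideanSpace ℝ (Fin 3) => g (z 2)) =
      g ∘ ⇑(EuclideanSpace.proj (2 : Fin 3) : EuclideanSpace ℝ (Fin 3) →L[ℝ] ℝ) := rfl
  rw [hfun, ContinuousLinearMap.iteratedFDeriv_comp_right _ hg y (by exact_mod_cast le_top)]
  refine (ContinuousMultilinearMap.norm_compContinuousLinearMap_le _ _).trans ?_
  have hprod : ∏ _i : Fin i, ‖(EuclideanSpace.proj (2 : Fin 3) : EuclideanSpace ℝ (Fin 3) →L[ℝ] ℝ)‖ ≤ 1 :=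
    Finset.prod_le_one (fun _ _ => norm_nonneg _) fun _ _ => norm_proj_le_one
  have h0 : 0 ≤ ‖iteratedFDeriv ℝ i g ((EuclideanSpace.proj (2 : Fin 3) : EuclideanSpace ℝ (Fin 3) →L[ℝ] ℝ) y)‖ :=
    norm_nonneg _
  calc ‖iteratedFDeriv ℝ i g ((EuclideanSpace.proj (2 : Fin 3) : EuclideanSpace ℝ (Fin 3) →L[ℝ] ℝ) y)‖ *
        ∏ _i : Fin i, ‖(EuclideanSpace.proj (2 : Fin 3) : EuclideanSpace ℝ (Fin 3) →L[ℝ] ℝ)‖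
      ≤ ‖iteratedFDeriv ℝ i g ((EuclideanSpace.proj (2 : Fin 3) : EuclideanSpace ℝ (Fin 3) →L[ℝ] ℝ) y)‖ * 1 :=
        mul_le_mul_of_nonneg_left hprod h0
    _ = |iteratedDeriv i g (y 2)| := by rw [mul_one, norm_iteratedFDeriv_eq_norm_iteratedDeriv, Real.norm_eq_abs]; rfl

/-- `‖Dⁱ(V₂)(y)‖ ≤ ‖DⁱV(y)‖`. [folklore] -/
theorem norm_iteratedFDeriv_coord_le (hV : ContDiff ℝ ∞ V) (i : ℕ) (y : EuclideanSpace ℝ (Fin 3)) :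
    ‖iteratedFDeriv ℝ i (fun z : EuclideanSpace ℝ (Fin 3) => V z 2) y‖ ≤ ‖iteratedFDeriv ℝ i V y‖ := by
  have hfun : (fun z : EuclideanSpace ℝ (Fin 3) => V z 2) =
      ⇑(EuclideanSpace.proj (2 : Fin 3) : EuclideanSpace ℝ (Fin 3) →L[ℝ] ℝ) ∘ V := rfl
  rw [hfun, ContinuousLinearMap.iteratedFDeriv_comp_left _ hV.contDiffAt (by exact_mod_cast le_top)]
  refine (ContinuousLinearMap.norm_compContinuousMultilinearMap_le _ _).trans ?_
  exact mul_le_of_le_one_left (norm_nonneg _) norm_proj_le_one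

/-- **Leibniz bounds for `g(x₂)V`**: `‖D¹(gV)‖ ≤ |g|‖D¹V‖ + |g′|‖V‖`, `‖D²(gV)‖ ≤ |g|‖D²V‖ + 2|g′|‖D¹V‖ + |g″|‖V‖`.
[folklore] -/
theorem norm_iteratedFDeriv_axialWeight_smul_le (hV : ContDiff ℝ ∞ V) (hg : ContDiff ℝ ∞ g) (y : EuclideanSpace ℝ (Fin 3)) :
    ‖iteratedFDeriv ℝ 1 (fun z : EuclideanSpace ℝ (Fin 3) => g (z 2) • V z) y‖ ≤
        |g (y 2)| * ‖iteratedFDeriv ℝ 1 V y‖ + |deriv g (y 2)| * ‖V y‖ ∧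
      ‖iteratedFDeriv ℝ 2 (fun z : EuclideanSpace ℝ (Fin 3) => g (z 2) • V z) y‖ ≤
        |g (y 2)| * ‖iteratedFDeriv ℝ 2 V y‖ + 2 * |deriv g (y 2)| * ‖iteratedFDeriv ℝ 1 V y‖ +
          |deriv (deriv g) (y 2)| * ‖V y‖ := by
  have ha : ContDiff ℝ ∞ fun z : EuclideanSpace ℝ (Fin 3) => g (z 2) :=
    hg.comp (EuclideanSpace.proj (2 : Fin 3) : EuclideanSpace ℝ (Fin 3) →L[ℝ] ℝ).contDiff
  have hb := fun i => norm_iteratedFDeriv_comp_coord_le hg i y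
  have hb0 : ‖iteratedFDeriv ℝ 0 (fun z : EuclideanSpace ℝ (Fin 3) => g (z 2)) y‖ ≤ |g (y 2)| := by
    have := hb 0; rwa [iteratedDeriv_zero] at this
  have hb1 : ‖iteratedFDeriv ℝ 1 (fun z : EuclideanSpace ℝ (Fin 3) => g (z 2)) y‖ ≤ |deriv g (y 2)| := by
    have := hb 1; rwa [iteratedDeriv_one] at this
  have hb2 : ‖iteratedFDeriv ℝ 2 (fun z : EuclideanSpace ℝ (Fin 3) => g (z 2)) y‖ ≤ |deriv (deriv g) (y 2)| := by
    have := hb 2; rwa [iteratedDeriv_succ, iteratedDeriv_one] at this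
  constructor
  · have h := norm_iteratedFDeriv_smul_le (n := 1) ha hV y (WithTop.coe_le_coe.mpr le_top)
    have h' : ‖iteratedFDeriv ℝ 1 (fun z : EuclideanSpace ℝ (Fin 3) => g (z 2) • V z) y‖ ≤
        ‖iteratedFDeriv ℝ 0 (fun z : EuclideanSpace ℝ (Fin 3) => g (z 2)) y‖ * ‖iteratedFDeriv ℝ 1 V y‖ +
          ‖iteratedFDeriv ℝ 1 (fun z : EuclideanSpace ℝ (Fin 3) => g (z 2)) y‖ * ‖iteratedFDeriv ℝ 0 V y‖ := by
      simp only [Finset.sum_range_succ, Finset.sum_range_zero, zero_add, Nat.choose_zero_right, Nat.cast_one,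
        one_mul, Nat.choose_self, Nat.sub_zero] at h
      exact h
    refine h'.trans (add_le_add ?_ ?_)
    · exact mul_le_mul_of_nonneg_right hb0 (norm_nonneg _)
    · rw [norm_iteratedFDeriv_zero]
      exact mul_le_mul_of_nonneg_right hb1 (norm_nonneg _)
  · have h := norm_iteratedFDeriv_smul_le (n := 2) ha hV y (WithTop.coe_le_coe.mpr le_top)
    have h' : ‖iteratedFDeriv ℝ 2 (fun z : EuclideanSpace ℝ (Fin 3) => g (z 2) • V z) y‖ ≤
        ‖iteratedFDeriv ℝ 0 (fun z : EuclideanSpace ℝ (Fin 3) => g (z 2)) y‖ * ‖iteratedFDeriv ℝ 2 V y‖ +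
          2 * ‖iteratedFDeriv ℝ 1 (fun z : EuclideanSpace ℝ (Fin 3) => g (z 2)) y‖ * ‖iteratedFDeriv ℝ 1 V y‖ +
          ‖iteratedFDeriv ℝ 2 (fun z : EuclideanSpace ℝ (Fin 3) => g (z 2)) y‖ * ‖iteratedFDeriv ℝ 0 V y‖ := by
      simp only [Finset.sum_range_succ, Finset.sum_range_zero, zero_add, Nat.choose_zero_right, Nat.cast_one,
        one_mul, Nat.choose_self, Nat.sub_zero, show Nat.choose 2 1 = 2 by rfl, Nat.cast_ofNat] at h
      exact h
    refine h'.trans (add_le_add (add_le_add ?_ ?_) ?_)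
    · exact mul_le_mul_of_nonneg_right hb0 (norm_nonneg _)
    · rw [mul_assoc, mul_assoc]
      exact mul_le_mul_of_nonneg_left (mul_le_mul_of_nonneg_right hb1 (norm_nonneg _)) zero_le_two
    · rw [norm_iteratedFDeriv_zero]
      exact mul_le_mul_of_nonneg_right hb2 (norm_nonneg _)

/-- **Leibniz bounds for `g′(x₂)V₂`**: `‖D¹(g′V₂)‖ ≤ |g′|‖D¹V‖ + |g″|‖V‖`, `‖D²(g′V₂)‖ ≤ |g′|‖D²V‖ + 2|g″|‖D¹V‖ + |g‴|‖V‖`.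
[folklore] -/
theorem norm_iteratedFDeriv_axialWeight_mul_coord_le (hV : ContDiff ℝ ∞ V) (hg : ContDiff ℝ ∞ g)
    (y : EuclideanSpace ℝ (Fin 3)) :
    ‖iteratedFDeriv ℝ 1 (fun z : EuclideanSpace ℝ (Fin 3) => deriv g (z 2) * V z 2) y‖ ≤
        |deriv g (y 2)| * ‖iteratedFDeriv ℝ 1 V y‖ + |deriv (deriv g) (y 2)| * ‖V y‖ ∧
      ‖iteratedFDeriv ℝ 2 (fun z : EuclideanSpace ℝ (Fin 3) => deriv g (z 2) * V z 2) y‖ ≤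
        |deriv g (y 2)| * ‖iteratedFDeriv ℝ 2 V y‖ + 2 * |deriv (deriv g) (y 2)| * ‖iteratedFDeriv ℝ 1 V y‖ +
          |deriv (deriv (deriv g)) (y 2)| * ‖V y‖ := by
  have hγ : ContDiff ℝ ∞ (deriv g) := (contDiff_infty_iff_deriv.mp hg).2
  have ha : ContDiff ℝ ∞ fun z : EuclideanSpace ℝ (Fin 3) => deriv g (z 2) :=
    hγ.comp (EuclideanSpace.proj (2 : Fin 3) : EuclideanSpace ℝ (Fin 3) →L[ℝ] ℝ).contDiff
  have hV2 : ContDiff ℝ ∞ fun z : EuclideanSpace ℝ (Fin 3) => V z 2 :=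
    (EuclideanSpace.proj (2 : Fin 3) : EuclideanSpace ℝ (Fin 3) →L[ℝ] ℝ).contDiff.comp hV
  have hb := fun i => norm_iteratedFDeriv_comp_coord_le hγ i y
  have hb0 : ‖iteratedFDeriv ℝ 0 (fun z : EuclideanSpace ℝ (Fin 3) => deriv g (z 2)) y‖ ≤ |deriv g (y 2)| := by
    have := hb 0; rwa [iteratedDeriv_zero] at this
  have hb1 : ‖iteratedFDeriv ℝ 1 (fun z : EuclideanSpace ℝ (Fin 3) => deriv g (z 2)) y‖ ≤ |deriv (deriv g) (y 2)| := by
    have := hb 1; rwa [iteratedDeriv_one] at this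
  have hb2 : ‖iteratedFDeriv ℝ 2 (fun z : EuclideanSpace ℝ (Fin 3) => deriv g (z 2)) y‖ ≤
      |deriv (deriv (deriv g)) (y 2)| := by
    have := hb 2; rwa [iteratedDeriv_succ, iteratedDeriv_one] at this
  have hc := fun i => norm_iteratedFDeriv_coord_le hV i y
  have hc0 : |V y 2| ≤ ‖V y‖ := by
    have := hc 0; rwa [norm_iteratedFDeriv_zero, norm_iteratedFDeriv_zero, Real.norm_eq_abs] at this
  constructor
  · have h := norm_iteratedFDeriv_mul_le (n := 1) ha hV2 y (WithTop.coe_le_coe.mpr le_top)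
    have h' : ‖iteratedFDeriv ℝ 1 (fun z : EuclideanSpace ℝ (Fin 3) => deriv g (z 2) * V z 2) y‖ ≤
        ‖iteratedFDeriv ℝ 0 (fun z : EuclideanSpace ℝ (Fin 3) => deriv g (z 2)) y‖ *
            ‖iteratedFDeriv ℝ 1 (fun z : EuclideanSpace ℝ (Fin 3) => V z 2) y‖ +
          ‖iteratedFDeriv ℝ 1 (fun z : EuclideanSpace ℝ (Fin 3) => deriv g (z 2)) y‖ *
            ‖iteratedFDeriv ℝ 0 (fun z : EuclideanSpace ℝ (Fin 3) => V z 2) y‖ := by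
      simp only [Finset.sum_range_succ, Finset.sum_range_zero, zero_add, Nat.choose_zero_right, Nat.cast_one,
        one_mul, Nat.choose_self, Nat.sub_zero] at h
      exact h
    refine h'.trans (add_le_add ?_ ?_)
    · exact mul_le_mul hb0 (hc 1) (norm_nonneg _) (abs_nonneg _)
    · rw [norm_iteratedFDeriv_zero, Real.norm_eq_abs]
      exact mul_le_mul hb1 hc0 (abs_nonneg _) (abs_nonneg _)
  · have h := norm_iteratedFDeriv_mul_le (n := 2) ha hV2 y (WithTop.coe_le_coe.mpr le_top)
    have h' : ‖iteratedFDeriv ℝ 2 (fun z : EuclideanSpace ℝ (Fin 3) => deriv g (z 2) * V z 2) y‖ ≤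
        ‖iteratedFDeriv ℝ 0 (fun z : EuclideanSpace ℝ (Fin 3) => deriv g (z 2)) y‖ *
            ‖iteratedFDeriv ℝ 2 (fun z : EuclideanSpace ℝ (Fin 3) => V z 2) y‖ +
          2 * ‖iteratedFDeriv ℝ 1 (fun z : EuclideanSpace ℝ (Fin 3) => deriv g (z 2)) y‖ *
            ‖iteratedFDeriv ℝ 1 (fun z : EuclideanSpace ℝ (Fin 3) => V z 2) y‖ +
          ‖iteratedFDeriv ℝ 2 (fun z : EuclideanSpace ℝ (Fin 3) => deriv g (z 2)) y‖ *
            ‖iteratedFDeriv ℝ 0 (fun z : EuclideanSpace ℝ (Fin 3) => V z 2) y‖ := by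
      simp only [Finset.sum_range_succ, Finset.sum_range_zero, zero_add, Nat.choose_zero_right, Nat.cast_one,
        one_mul, Nat.choose_self, Nat.sub_zero, show Nat.choose 2 1 = 2 by rfl, Nat.cast_ofNat] at h
      exact h
    refine h'.trans (add_le_add (add_le_add ?_ ?_) ?_)
    · exact mul_le_mul hb0 (hc 2) (norm_nonneg _) (abs_nonneg _)
    · rw [mul_assoc, mul_assoc]
      exact mul_le_mul_of_nonneg_left (mul_le_mul hb1 (hc 1) (norm_nonneg _) (abs_nonneg _)) zero_le_two
    · rw [norm_iteratedFDeriv_zero, Real.norm_eq_abs]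
      exact mul_le_mul hb2 hc0 (abs_nonneg _) (abs_nonneg _)

/-! ## 2. `D¹, D²` of `g(x₂)V` and of `g′(x₂)V₂` are square integrable on a square-integrable slab -/

/-- The slab bound: `w(x₂)²‖V(x)‖² ≤ K²·𝟙_{|x₂| ≤ T}‖V(x)‖²` when `|w| ≤ K` and `w = 0` off `[−T, T]`. [folklore] -/
theorem sq_mul_sq_le_indicator {w : ℝ → ℝ} {K T : ℝ} (hK : ∀ s, |w s| ≤ K) (hT : ∀ s, T < |s| → w s = 0)
    (x : EuclideanSpace ℝ (Fin 3)) :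
    w (x 2) ^ 2 * ‖V x‖ ^ 2 ≤ K ^ 2 * {x : EuclideanSpace ℝ (Fin 3) | |x 2| ≤ T}.indicator (fun x => ‖V x‖ ^ 2) x := by
  by_cases hx : x ∈ {x : EuclideanSpace ℝ (Fin 3) | |x 2| ≤ T}
  · rw [Set.indicator_of_mem hx]
    have : w (x 2) ^ 2 ≤ K ^ 2 := by
      rw [← sq_abs]; exact pow_le_pow_left₀ (abs_nonneg _) (hK _) 2
    exact mul_le_mul_of_nonneg_right this (sq_nonneg _)
  · rw [Set.indicator_of_notMem hx, mul_zero]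
    have hx' : T < |x 2| := not_le.1 hx
    rw [hT _ hx']; simp

/-- **`D¹(gV), D²(gV) ∈ L²`** for `g, g′, g″` bounded with `g′ = g″ = 0` off `[−T,T]`, `D¹V, D²V ∈ L²` and the slab
`{|x₂| ≤ T}` square integrable. [folklore] -/
theorem lintegral_iteratedFDeriv_axialWeight_smul_lt_top (hV : ContDiff ℝ ∞ V) (hg : ContDiff ℝ ∞ g) {T K0 K1 K2 : ℝ}
    (hK0 : ∀ s, |g s| ≤ K0) (hK1 : ∀ s, |deriv g s| ≤ K1) (hK2 : ∀ s, |deriv (deriv g) s| ≤ K2)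
    (hT1 : ∀ s, T < |s| → deriv g s = 0) (hT2 : ∀ s, T < |s| → deriv (deriv g) s = 0)
    (h1 : ∫⁻ x, ‖iteratedFDeriv ℝ 1 V x‖ₑ ^ 2 < ⊤) (h2 : ∫⁻ x, ‖iteratedFDeriv ℝ 2 V x‖ₑ ^ 2 < ⊤)
    (hslab : Integrable (fun x => {x : EuclideanSpace ℝ (Fin 3) | |x 2| ≤ T}.indicator (fun x => ‖V x‖ ^ 2) x) volume) :
    (∫⁻ x, ‖iteratedFDeriv ℝ 1 (fun z : EuclideanSpace ℝ (Fin 3) => g (z 2) • V z) x‖ₑ ^ 2 < ⊤) ∧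
      (∫⁻ x, ‖iteratedFDeriv ℝ 2 (fun z : EuclideanSpace ℝ (Fin 3) => g (z 2) • V z) x‖ₑ ^ 2 < ⊤) := by
  set S : Set (EuclideanSpace ℝ (Fin 3)) := {x | |x 2| ≤ T} with hS
  have hΨ : ContDiff ℝ ∞ fun z : EuclideanSpace ℝ (Fin 3) => g (z 2) • V z :=
    (hg.comp (EuclideanSpace.proj (2 : Fin 3) : EuclideanSpace ℝ (Fin 3) →L[ℝ] ℝ).contDiff).smul hV
  have hD1 : Integrable (fun x => ‖iteratedFDeriv ℝ 1 V x‖ ^ 2) :=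
    integrable_sq_norm_of_lintegral (hV.continuous_iteratedFDeriv (WithTop.coe_le_coe.mpr le_top)) h1
  have hD2 : Integrable (fun x => ‖iteratedFDeriv ℝ 2 V x‖ ^ 2) :=
    integrable_sq_norm_of_lintegral (hV.continuous_iteratedFDeriv (WithTop.coe_le_coe.mpr le_top)) h2
  have hsl1 := fun x => sq_mul_sq_le_indicator (V := V) hK1 hT1 x
  have hsl2 := fun x => sq_mul_sq_le_indicator (V := V) hK2 hT2 x
  have hg0 : ∀ x : EuclideanSpace ℝ (Fin 3), g (x 2) ^ 2 ≤ K0 ^ 2 := fun x => by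
    rw [← sq_abs]; exact pow_le_pow_left₀ (abs_nonneg _) (hK0 _) 2
  have hg1 : ∀ x : EuclideanSpace ℝ (Fin 3), deriv g (x 2) ^ 2 ≤ K1 ^ 2 := fun x => by
    rw [← sq_abs]; exact pow_le_pow_left₀ (abs_nonneg _) (hK1 _) 2
  constructor
  · refine lintegral_sq_lt_top_of_bound (hΨ.continuous_iteratedFDeriv (WithTop.coe_le_coe.mpr le_top))
      (((hD1.const_mul (K0 ^ 2)).add (hslab.const_mul (K1 ^ 2))).const_mul 2) fun x => ?_
    have hle := (norm_iteratedFDeriv_axialWeight_smul_le hV hg x).1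
    have ha := hg0 x
    have hb := hsl1 x
    have hn := norm_nonneg (iteratedFDeriv ℝ 1 (fun z : EuclideanSpace ℝ (Fin 3) => g (z 2) • V z) x)
    calc ‖iteratedFDeriv ℝ 1 (fun z : EuclideanSpace ℝ (Fin 3) => g (z 2) • V z) x‖ ^ 2
        ≤ (|g (x 2)| * ‖iteratedFDeriv ℝ 1 V x‖ + |deriv g (x 2)| * ‖V x‖) ^ 2 := pow_le_pow_left₀ hn hle 2
      _ ≤ 2 * (g (x 2) ^ 2 * ‖iteratedFDeriv ℝ 1 V x‖ ^ 2 + deriv g (x 2) ^ 2 * ‖V x‖ ^ 2) := by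
          rw [← sq_abs (g (x 2)), ← sq_abs (deriv g (x 2))]
          nlinarith [sq_nonneg (|g (x 2)| * ‖iteratedFDeriv ℝ 1 V x‖ - |deriv g (x 2)| * ‖V x‖)]
      _ ≤ 2 * (K0 ^ 2 * ‖iteratedFDeriv ℝ 1 V x‖ ^ 2 + K1 ^ 2 * S.indicator (fun x => ‖V x‖ ^ 2) x) := by
          gcongr
  · refine lintegral_sq_lt_top_of_bound (hΨ.continuous_iteratedFDeriv (WithTop.coe_le_coe.mpr le_top))
      ((((hD2.const_mul (K0 ^ 2)).add (hD1.const_mul (4 * K1 ^ 2))).add (hslab.const_mul (K2 ^ 2))).const_mul 3)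
      fun x => ?_
    have hle := (norm_iteratedFDeriv_axialWeight_smul_le hV hg x).2
    have ha := hg0 x
    have ha1 := hg1 x
    have hb := hsl2 x
    have hn := norm_nonneg (iteratedFDeriv ℝ 2 (fun z : EuclideanSpace ℝ (Fin 3) => g (z 2) • V z) x)
    calc ‖iteratedFDeriv ℝ 2 (fun z : EuclideanSpace ℝ (Fin 3) => g (z 2) • V z) x‖ ^ 2
        ≤ (|g (x 2)| * ‖iteratedFDeriv ℝ 2 V x‖ + 2 * |deriv g (x 2)| * ‖iteratedFDeriv ℝ 1 V x‖ +
            |deriv (deriv g) (x 2)| * ‖V x‖) ^ 2 := pow_le_pow_left₀ hn hle 2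
      _ ≤ 3 * (g (x 2) ^ 2 * ‖iteratedFDeriv ℝ 2 V x‖ ^ 2 + 4 * deriv g (x 2) ^ 2 * ‖iteratedFDeriv ℝ 1 V x‖ ^ 2 +
            deriv (deriv g) (x 2) ^ 2 * ‖V x‖ ^ 2) := by
          rw [← sq_abs (g (x 2)), ← sq_abs (deriv g (x 2)), ← sq_abs (deriv (deriv g) (x 2))]
          nlinarith [sq_nonneg (|g (x 2)| * ‖iteratedFDeriv ℝ 2 V x‖ - 2 * |deriv g (x 2)| * ‖iteratedFDeriv ℝ 1 V x‖),
            sq_nonneg (|g (x 2)| * ‖iteratedFDeriv ℝ 2 V x‖ - |deriv (deriv g) (x 2)| * ‖V x‖),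
            sq_nonneg (2 * |deriv g (x 2)| * ‖iteratedFDeriv ℝ 1 V x‖ - |deriv (deriv g) (x 2)| * ‖V x‖)]
      _ ≤ 3 * (K0 ^ 2 * ‖iteratedFDeriv ℝ 2 V x‖ ^ 2 + 4 * K1 ^ 2 * ‖iteratedFDeriv ℝ 1 V x‖ ^ 2 +
            K2 ^ 2 * S.indicator (fun x => ‖V x‖ ^ 2) x) := by
          gcongr

/-- **`D¹(g′V₂), D²(g′V₂) ∈ L²`** under the same hypotheses plus `g‴` bounded and vanishing off `[−T,T]`. [folklore] -/
theorem lintegral_iteratedFDeriv_axialWeight_mul_coord_lt_top (hV : ContDiff ℝ ∞ V) (hg : ContDiff ℝ ∞ g)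
    {T K1 K2 K3 : ℝ} (hK1 : ∀ s, |deriv g s| ≤ K1) (hK2 : ∀ s, |deriv (deriv g) s| ≤ K2)
    (hK3 : ∀ s, |deriv (deriv (deriv g)) s| ≤ K3)
    (hT2 : ∀ s, T < |s| → deriv (deriv g) s = 0) (hT3 : ∀ s, T < |s| → deriv (deriv (deriv g)) s = 0)
    (h1 : ∫⁻ x, ‖iteratedFDeriv ℝ 1 V x‖ₑ ^ 2 < ⊤) (h2 : ∫⁻ x, ‖iteratedFDeriv ℝ 2 V x‖ₑ ^ 2 < ⊤)
    (hslab : Integrable (fun x => {x : EuclideanSpace ℝ (Fin 3) | |x 2| ≤ T}.indicator (fun x => ‖V x‖ ^ 2) x) volume) :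
    (∫⁻ x, ‖iteratedFDeriv ℝ 1 (fun z : EuclideanSpace ℝ (Fin 3) => deriv g (z 2) * V z 2) x‖ₑ ^ 2 < ⊤) ∧
      (∫⁻ x, ‖iteratedFDeriv ℝ 2 (fun z : EuclideanSpace ℝ (Fin 3) => deriv g (z 2) * V z 2) x‖ₑ ^ 2 < ⊤) := by
  set S : Set (EuclideanSpace ℝ (Fin 3)) := {x | |x 2| ≤ T} with hS
  have hγ : ContDiff ℝ ∞ (deriv g) := (contDiff_infty_iff_deriv.mp hg).2
  have hG : ContDiff ℝ ∞ fun z : EuclideanSpace ℝ (Fin 3) => deriv g (z 2) * V z 2 :=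
    (hγ.comp (EuclideanSpace.proj (2 : Fin 3) : EuclideanSpace ℝ (Fin 3) →L[ℝ] ℝ).contDiff).mul
      ((EuclideanSpace.proj (2 : Fin 3) : EuclideanSpace ℝ (Fin 3) →L[ℝ] ℝ).contDiff.comp hV)
  have hD1 : Integrable (fun x => ‖iteratedFDeriv ℝ 1 V x‖ ^ 2) :=
    integrable_sq_norm_of_lintegral (hV.continuous_iteratedFDeriv (WithTop.coe_le_coe.mpr le_top)) h1
  have hD2 : Integrable (fun x => ‖iteratedFDeriv ℝ 2 V x‖ ^ 2) :=
    integrable_sq_norm_of_lintegral (hV.continuous_iteratedFDeriv (WithTop.coe_le_coe.mpr le_top)) h2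
  have hsl2 := fun x => sq_mul_sq_le_indicator (V := V) hK2 hT2 x
  have hsl3 := fun x => sq_mul_sq_le_indicator (V := V) hK3 hT3 x
  have hg1 : ∀ x : EuclideanSpace ℝ (Fin 3), deriv g (x 2) ^ 2 ≤ K1 ^ 2 := fun x => by
    rw [← sq_abs]; exact pow_le_pow_left₀ (abs_nonneg _) (hK1 _) 2
  have hg2 : ∀ x : EuclideanSpace ℝ (Fin 3), deriv (deriv g) (x 2) ^ 2 ≤ K2 ^ 2 := fun x => by
    rw [← sq_abs]; exact pow_le_pow_left₀ (abs_nonneg _) (hK2 _) 2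
  constructor
  · refine lintegral_sq_lt_top_of_bound (hG.continuous_iteratedFDeriv (WithTop.coe_le_coe.mpr le_top))
      (((hD1.const_mul (K1 ^ 2)).add (hslab.const_mul (K2 ^ 2))).const_mul 2) fun x => ?_
    have hle := (norm_iteratedFDeriv_axialWeight_mul_coord_le hV hg x).1
    have ha := hg1 x
    have hb := hsl2 x
    have hn := norm_nonneg (iteratedFDeriv ℝ 1 (fun z : EuclideanSpace ℝ (Fin 3) => deriv g (z 2) * V z 2) x)
    calc ‖iteratedFDeriv ℝ 1 (fun z : EuclideanSpace ℝ (Fin 3) => deriv g (z 2) * V z 2) x‖ ^ 2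
        ≤ (|deriv g (x 2)| * ‖iteratedFDeriv ℝ 1 V x‖ + |deriv (deriv g) (x 2)| * ‖V x‖) ^ 2 := pow_le_pow_left₀ hn hle 2
      _ ≤ 2 * (deriv g (x 2) ^ 2 * ‖iteratedFDeriv ℝ 1 V x‖ ^ 2 + deriv (deriv g) (x 2) ^ 2 * ‖V x‖ ^ 2) := by
          rw [← sq_abs (deriv g (x 2)), ← sq_abs (deriv (deriv g) (x 2))]
          nlinarith [sq_nonneg (|deriv g (x 2)| * ‖iteratedFDeriv ℝ 1 V x‖ - |deriv (deriv g) (x 2)| * ‖V x‖)]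
      _ ≤ 2 * (K1 ^ 2 * ‖iteratedFDeriv ℝ 1 V x‖ ^ 2 + K2 ^ 2 * S.indicator (fun x => ‖V x‖ ^ 2) x) := by
          gcongr
  · refine lintegral_sq_lt_top_of_bound (hG.continuous_iteratedFDeriv (WithTop.coe_le_coe.mpr le_top))
      ((((hD2.const_mul (K1 ^ 2)).add (hD1.const_mul (4 * K2 ^ 2))).add (hslab.const_mul (K3 ^ 2))).const_mul 3)
      fun x => ?_
    have hle := (norm_iteratedFDeriv_axialWeight_mul_coord_le hV hg x).2
    have ha := hg1 x
    have ha2 := hg2 x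
    have hb := hsl3 x
    have hn := norm_nonneg (iteratedFDeriv ℝ 2 (fun z : EuclideanSpace ℝ (Fin 3) => deriv g (z 2) * V z 2) x)
    calc ‖iteratedFDeriv ℝ 2 (fun z : EuclideanSpace ℝ (Fin 3) => deriv g (z 2) * V z 2) x‖ ^ 2
        ≤ (|deriv g (x 2)| * ‖iteratedFDeriv ℝ 2 V x‖ + 2 * |deriv (deriv g) (x 2)| * ‖iteratedFDeriv ℝ 1 V x‖ +
            |deriv (deriv (deriv g)) (x 2)| * ‖V x‖) ^ 2 := pow_le_pow_left₀ hn hle 2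
      _ ≤ 3 * (deriv g (x 2) ^ 2 * ‖iteratedFDeriv ℝ 2 V x‖ ^ 2 +
            4 * deriv (deriv g) (x 2) ^ 2 * ‖iteratedFDeriv ℝ 1 V x‖ ^ 2 +
            deriv (deriv (deriv g)) (x 2) ^ 2 * ‖V x‖ ^ 2) := by
          rw [← sq_abs (deriv g (x 2)), ← sq_abs (deriv (deriv g) (x 2)), ← sq_abs (deriv (deriv (deriv g)) (x 2))]
          nlinarith [sq_nonneg (|deriv g (x 2)| * ‖iteratedFDeriv ℝ 2 V x‖ -
              2 * |deriv (deriv g) (x 2)| * ‖iteratedFDeriv ℝ 1 V x‖),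
            sq_nonneg (|deriv g (x 2)| * ‖iteratedFDeriv ℝ 2 V x‖ - |deriv (deriv (deriv g)) (x 2)| * ‖V x‖),
            sq_nonneg (2 * |deriv (deriv g) (x 2)| * ‖iteratedFDeriv ℝ 1 V x‖ -
              |deriv (deriv (deriv g)) (x 2)| * ‖V x‖)]
      _ ≤ 3 * (K1 ^ 2 * ‖iteratedFDeriv ℝ 2 V x‖ ^ 2 + 4 * K2 ^ 2 * ‖iteratedFDeriv ℝ 1 V x‖ ^ 2 +
            K3 ^ 2 * S.indicator (fun x => ‖V x‖ ^ 2) x) := by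
          gcongr

/-! ## 3. Assembly: `D¹φ̂_h, D²φ̂_h ∈ L²` -/

/-- **The discrete slide direction has `D¹φ̂_h, D²φ̂_h ∈ L²`** (`V, g ∈ C^∞`; `g, g′, g″, g‴` bounded; `g′, g″, g‴ = 0` off
`[−T, T]`; `D¹V, D²V ∈ L²`; the slab `{|x₂| ≤ T}` square integrable; `h ≥ 0`). [folklore] -/
theorem lintegral_iteratedFDeriv_slideQuotient_lt_top (hV : ContDiff ℝ ∞ V) (hg : ContDiff ℝ ∞ g) {T K0 K1 K2 K3 : ℝ}
    (hK0 : ∀ s, |g s| ≤ K0) (hK1 : ∀ s, |deriv g s| ≤ K1) (hK2 : ∀ s, |deriv (deriv g) s| ≤ K2)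
    (hK3 : ∀ s, |deriv (deriv (deriv g)) s| ≤ K3)
    (hT1 : ∀ s, T < |s| → deriv g s = 0) (hT2 : ∀ s, T < |s| → deriv (deriv g) s = 0)
    (hT3 : ∀ s, T < |s| → deriv (deriv (deriv g)) s = 0)
    (h1 : ∫⁻ x, ‖iteratedFDeriv ℝ 1 V x‖ₑ ^ 2 < ⊤) (h2 : ∫⁻ x, ‖iteratedFDeriv ℝ 2 V x‖ₑ ^ 2 < ⊤)
    (hslab : Integrable (fun x => {x : EuclideanSpace ℝ (Fin 3) | |x 2| ≤ T}.indicator (fun x => ‖V x‖ ^ 2) x) volume)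
    {h : ℝ} (hh : 0 ≤ h) :
    (∫⁻ x, ‖iteratedFDeriv ℝ 1 (fun x : EuclideanSpace ℝ (Fin 3) =>
        g (x 2) • V x - g ((x + (-h) • EuclideanSpace.single (2 : Fin 3) (1 : ℝ)) 2) •
            V (x + (-h) • EuclideanSpace.single (2 : Fin 3) (1 : ℝ)) -
          (∫ t in (-h)..0, deriv g ((x + t • EuclideanSpace.single (2 : Fin 3) (1 : ℝ)) 2) *
              V (x + t • EuclideanSpace.single (2 : Fin 3) (1 : ℝ)) 2) • EuclideanSpace.single (2 : Fin 3) (1 : ℝ)) x‖ₑ ^ 2 < ⊤) ∧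
    (∫⁻ x, ‖iteratedFDeriv ℝ 2 (fun x : EuclideanSpace ℝ (Fin 3) =>
        g (x 2) • V x - g ((x + (-h) • EuclideanSpace.single (2 : Fin 3) (1 : ℝ)) 2) •
            V (x + (-h) • EuclideanSpace.single (2 : Fin 3) (1 : ℝ)) -
          (∫ t in (-h)..0, deriv g ((x + t • EuclideanSpace.single (2 : Fin 3) (1 : ℝ)) 2) *
              V (x + t • EuclideanSpace.single (2 : Fin 3) (1 : ℝ)) 2) • EuclideanSpace.single (2 : Fin 3) (1 : ℝ)) x‖ₑ ^ 2 < ⊤) := by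
  set e₂ : EuclideanSpace ℝ (Fin 3) := EuclideanSpace.single (2 : Fin 3) (1 : ℝ) with he₂
  set Ψ : EuclideanSpace ℝ (Fin 3) → EuclideanSpace ℝ (Fin 3) := fun y => g (y 2) • V y with hΨ
  set G : EuclideanSpace ℝ (Fin 3) → ℝ := fun y => deriv g (y 2) * V y 2 with hG
  set Sf : EuclideanSpace ℝ (Fin 3) → EuclideanSpace ℝ (Fin 3) := fun y => (∫ t in (-h)..0, G (y + t • e₂)) • e₂ with hSf
  have hproj : ContDiff ℝ ∞ fun y : EuclideanSpace ℝ (Fin 3) => y 2 :=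
    (EuclideanSpace.proj (2 : Fin 3) : EuclideanSpace ℝ (Fin 3) →L[ℝ] ℝ).contDiff
  have hΨs : ContDiff ℝ ∞ Ψ := (hg.comp hproj).smul hV
  have hΨas : ContDiff ℝ ∞ fun y => Ψ (y + (-h) • e₂) := hΨs.comp (contDiff_id.add contDiff_const)
  have hγ : ContDiff ℝ ∞ (deriv g) := (contDiff_infty_iff_deriv.mp hg).2
  have hGs : ContDiff ℝ ∞ G := (hγ.comp hproj).mul (hproj.comp hV)
  have hH : ContDiff ℝ ∞ fun q : ℝ × EuclideanSpace ℝ (Fin 3) => G (q.2 + q.1 • e₂) :=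
    hGs.comp (contDiff_snd.add (contDiff_fst.smul contDiff_const))
  have hFs : ContDiff ℝ ∞ fun y : EuclideanSpace ℝ (Fin 3) => ∫ t in (-h)..0, G (y + t • e₂) :=
    Literature.Analysis.FunctionSpaces.contDiff_parametric_intervalIntegral
      (H := fun q : ℝ × EuclideanSpace ℝ (Fin 3) => G (q.2 + q.1 • e₂)) hH (-h) 0
  have hSs : ContDiff ℝ ∞ Sf := hFs.smul contDiff_const
  obtain ⟨hΨ1, hΨ2⟩ := lintegral_iteratedFDeriv_axialWeight_smul_lt_top hV hg hK0 hK1 hK2 hT1 hT2 h1 h2 hslab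
  obtain ⟨hG1, hG2⟩ := lintegral_iteratedFDeriv_axialWeight_mul_coord_lt_top hV hg hK1 hK2 hK3 hT2 hT3 h1 h2 hslab
  have hS1 : ∫⁻ x, ‖iteratedFDeriv ℝ 1 Sf x‖ₑ ^ 2 < ⊤ := lintegral_iteratedFDeriv_verticalIntegral_smul_lt_top hGs hG1 hh
  have hS2 : ∫⁻ x, ‖iteratedFDeriv ℝ 2 Sf x‖ₑ ^ 2 < ⊤ := lintegral_iteratedFDeriv_verticalIntegral_smul_lt_top hGs hG2 hh
  have hΨa1 : ∫⁻ x, ‖iteratedFDeriv ℝ 1 (fun y => Ψ (y + (-h) • e₂)) x‖ₑ ^ 2 < ⊤ := by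
    rw [lintegral_iteratedFDeriv_comp_add_right_eq]; exact hΨ1
  have hΨa2 : ∫⁻ x, ‖iteratedFDeriv ℝ 2 (fun y => Ψ (y + (-h) • e₂)) x‖ₑ ^ 2 < ⊤ := by
    rw [lintegral_iteratedFDeriv_comp_add_right_eq]; exact hΨ2
  set D : EuclideanSpace ℝ (Fin 3) → EuclideanSpace ℝ (Fin 3) := fun y => Ψ y + (-1 : ℝ) • Ψ (y + (-h) • e₂) with hD
  have hDs : ContDiff ℝ ∞ D := hΨs.add (hΨas.const_smul (-1 : ℝ))
  have hD1 : ∫⁻ x, ‖iteratedFDeriv ℝ 1 D x‖ₑ ^ 2 < ⊤ := lintegral_iteratedFDeriv_add_smul_lt_top_global hΨs hΨas (-1) hΨ1 hΨa1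
  have hD2 : ∫⁻ x, ‖iteratedFDeriv ℝ 2 D x‖ₑ ^ 2 < ⊤ := lintegral_iteratedFDeriv_add_smul_lt_top_global hΨs hΨas (-1) hΨ2 hΨa2
  have hfun : (fun x : EuclideanSpace ℝ (Fin 3) => g (x 2) • V x - g ((x + (-h) • e₂) 2) • V (x + (-h) • e₂) -
      (∫ t in (-h)..0, deriv g ((x + t • e₂) 2) * V (x + t • e₂) 2) • e₂) = fun y => D y + (-1 : ℝ) • Sf y := by
    funext y
    simp only [hD, hSf, hΨ, hG]
    module
  rw [hfun]
  exact ⟨lintegral_iteratedFDeriv_add_smul_lt_top_global hDs hSs (-1) hD1 hS1,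
    lintegral_iteratedFDeriv_add_smul_lt_top_global hDs hSs (-1) hD2 hS2⟩

end ExtremiserLiouville

end Summit.NavierStokesRegularity.NavierStokesRegularity.Theorems

end
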